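import Summits.BirchSwinnertonDyer.BirchSwinnertonDyer.Theorems.Rank2ObservatoryRank3Census
import Summits.BirchSwinnertonDyer.BirchSwinnertonDyer.Theorems.Rank2ObservatoryRank2Table
import HarnessLib

/-!
# BirchSwinnertonDyer — rank ≥ 2 observatory: census glue for the rank-3 kernel certificates

HONEST FRAMING: per-curve certified theorems and census instruments; no claim on BSD in rank ≥ 2.

Glue used by the rank-3 kernel-certificate index files (`Rank2ObservatoryRank3KernelCertsIndexNN`):
chunk membership `r ∈ rank3RowsNN → r ∈ rank3Table` (27 lemmas, by `List.mem_append`; no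
`DecidableEq Rank3Row` is needed — a row's position in its chunk is certified by `rfl` on
`rank3RowsNN[i]?`), and the census-row consequences of a DISCHARGED `hlow : 3 ≤ rank_ℤ E(ℚ)`:
`Rank3Row.lvalues_eq_zero_of_three_le` (`L(E,1) = L′(E,1) = 0` exactly over `ℚ`, given only
Gross–Zagier–Kolyvagin `hGZK` = bsd.S17 as a named hypothesis), and the census theorems
`analyticRank_eq_rank_of_mem` / `rank3_lderiv_eq_zero_of_mem` with `hlow` no longer a hypothesis
(`…_of_three_le`). No data, no definitions; sorry-free.

References: Cremona (1997) §2.13 and Tables; Gross, LMS LNS 153 (1991); Darmon (2004) Thm. 3.22.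
-/

-- single-conjunct summit: `Summit.BirchSwinnertonDyer.BirchSwinnertonDyer.…` repeats the name by design
set_option linter.dupNamespace false

noncomputable section

open scoped Classical

namespace Summit.BirchSwinnertonDyer.BirchSwinnertonDyer.Rank2Observatory

open Literature Literature.NumberTheory.EllipticCurves WeierstrassCurve

/-- Rows of chunk `rank3Rows01` are rows of the census table. [folklore] -/
theorem mem_rank3Table_of_mem_rows01 {r : Rank3Row} (h : r ∈ rank3Rows01) : r ∈ rank3Table := by
  simp only [rank3Table, List.mem_append]; tauto

/-- Rows of chunk `rank3Rows02` are rows of the census table. [folklore] -/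
theorem mem_rank3Table_of_mem_rows02 {r : Rank3Row} (h : r ∈ rank3Rows02) : r ∈ rank3Table := by
  simp only [rank3Table, List.mem_append]; tauto

/-- Rows of chunk `rank3Rows03` are rows of the census table. [folklore] -/
theorem mem_rank3Table_of_mem_rows03 {r : Rank3Row} (h : r ∈ rank3Rows03) : r ∈ rank3Table := by
  simp only [rank3Table, List.mem_append]; tauto

/-- Rows of chunk `rank3Rows04` are rows of the census table. [folklore] -/
theorem mem_rank3Table_of_mem_rows04 {r : Rank3Row} (h : r ∈ rank3Rows04) : r ∈ rank3Table := by
  simp only [rank3Table, List.mem_append]; tauto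

/-- Rows of chunk `rank3Rows05` are rows of the census table. [folklore] -/
theorem mem_rank3Table_of_mem_rows05 {r : Rank3Row} (h : r ∈ rank3Rows05) : r ∈ rank3Table := by
  simp only [rank3Table, List.mem_append]; tauto

/-- Rows of chunk `rank3Rows06` are rows of the census table. [folklore] -/
theorem mem_rank3Table_of_mem_rows06 {r : Rank3Row} (h : r ∈ rank3Rows06) : r ∈ rank3Table := by
  simp only [rank3Table, List.mem_append]; tauto

/-- Rows of chunk `rank3Rows07` are rows of the census table. [folklore] -/
theorem mem_rank3Table_of_mem_rows07 {r : Rank3Row} (h : r ∈ rank3Rows07) : r ∈ rank3Table := by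
  simp only [rank3Table, List.mem_append]; tauto

/-- Rows of chunk `rank3Rows08` are rows of the census table. [folklore] -/
theorem mem_rank3Table_of_mem_rows08 {r : Rank3Row} (h : r ∈ rank3Rows08) : r ∈ rank3Table := by
  simp only [rank3Table, List.mem_append]; tauto

/-- Rows of chunk `rank3Rows09` are rows of the census table. [folklore] -/
theorem mem_rank3Table_of_mem_rows09 {r : Rank3Row} (h : r ∈ rank3Rows09) : r ∈ rank3Table := by
  simp only [rank3Table, List.mem_append]; tauto

/-- Rows of chunk `rank3Rows10` are rows of the census table. [folklore] -/
theorem mem_rank3Table_of_mem_rows10 {r : Rank3Row} (h : r ∈ rank3Rows10) : r ∈ rank3Table := by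
  simp only [rank3Table, List.mem_append]; tauto

/-- Rows of chunk `rank3Rows11` are rows of the census table. [folklore] -/
theorem mem_rank3Table_of_mem_rows11 {r : Rank3Row} (h : r ∈ rank3Rows11) : r ∈ rank3Table := by
  simp only [rank3Table, List.mem_append]; tauto

/-- Rows of chunk `rank3Rows12` are rows of the census table. [folklore] -/
theorem mem_rank3Table_of_mem_rows12 {r : Rank3Row} (h : r ∈ rank3Rows12) : r ∈ rank3Table := by
  simp only [rank3Table, List.mem_append]; tauto

/-- Rows of chunk `rank3Rows13` are rows of the census table. [folklore] -/
theorem mem_rank3Table_of_mem_rows13 {r : Rank3Row} (h : r ∈ rank3Rows13) : r ∈ rank3Table := by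
  simp only [rank3Table, List.mem_append]; tauto

/-- Rows of chunk `rank3Rows14` are rows of the census table. [folklore] -/
theorem mem_rank3Table_of_mem_rows14 {r : Rank3Row} (h : r ∈ rank3Rows14) : r ∈ rank3Table := by
  simp only [rank3Table, List.mem_append]; tauto

/-- Rows of chunk `rank3Rows15` are rows of the census table. [folklore] -/
theorem mem_rank3Table_of_mem_rows15 {r : Rank3Row} (h : r ∈ rank3Rows15) : r ∈ rank3Table := by
  simp only [rank3Table, List.mem_append]; tauto

/-- Rows of chunk `rank3Rows16` are rows of the census table. [folklore] -/
theorem mem_rank3Table_of_mem_rows16 {r : Rank3Row} (h : r ∈ rank3Rows16) : r ∈ rank3Table := by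
  simp only [rank3Table, List.mem_append]; tauto

/-- Rows of chunk `rank3Rows17` are rows of the census table. [folklore] -/
theorem mem_rank3Table_of_mem_rows17 {r : Rank3Row} (h : r ∈ rank3Rows17) : r ∈ rank3Table := by
  simp only [rank3Table, List.mem_append]; tauto

/-- Rows of chunk `rank3Rows18` are rows of the census table. [folklore] -/
theorem mem_rank3Table_of_mem_rows18 {r : Rank3Row} (h : r ∈ rank3Rows18) : r ∈ rank3Table := by
  simp only [rank3Table, List.mem_append]; tauto

/-- Rows of chunk `rank3Rows19` are rows of the census table. [folklore] -/
theorem mem_rank3Table_of_mem_rows19 {r : Rank3Row} (h : r ∈ rank3Rows19) : r ∈ rank3Table := by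
  simp only [rank3Table, List.mem_append]; tauto

/-- Rows of chunk `rank3Rows20` are rows of the census table. [folklore] -/
theorem mem_rank3Table_of_mem_rows20 {r : Rank3Row} (h : r ∈ rank3Rows20) : r ∈ rank3Table := by
  simp only [rank3Table, List.mem_append]; tauto

/-- Rows of chunk `rank3Rows21` are rows of the census table. [folklore] -/
theorem mem_rank3Table_of_mem_rows21 {r : Rank3Row} (h : r ∈ rank3Rows21) : r ∈ rank3Table := by
  simp only [rank3Table, List.mem_append]; tauto

/-- Rows of chunk `rank3Rows22` are rows of the census table. [folklore] -/
theorem mem_rank3Table_of_mem_rows22 {r : Rank3Row} (h : r ∈ rank3Rows22) : r ∈ rank3Table := by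
  simp only [rank3Table, List.mem_append]; tauto

/-- Rows of chunk `rank3Rows23` are rows of the census table. [folklore] -/
theorem mem_rank3Table_of_mem_rows23 {r : Rank3Row} (h : r ∈ rank3Rows23) : r ∈ rank3Table := by
  simp only [rank3Table, List.mem_append]; tauto

/-- Rows of chunk `rank3Rows24` are rows of the census table. [folklore] -/
theorem mem_rank3Table_of_mem_rows24 {r : Rank3Row} (h : r ∈ rank3Rows24) : r ∈ rank3Table := by
  simp only [rank3Table, List.mem_append]; tauto

/-- Rows of chunk `rank3Rows25` are rows of the census table. [folklore] -/
theorem mem_rank3Table_of_mem_rows25 {r : Rank3Row} (h : r ∈ rank3Rows25) : r ∈ rank3Table := by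
  simp only [rank3Table, List.mem_append]; tauto

/-- Rows of chunk `rank3Rows26` are rows of the census table. [folklore] -/
theorem mem_rank3Table_of_mem_rows26 {r : Rank3Row} (h : r ∈ rank3Rows26) : r ∈ rank3Table := by
  simp only [rank3Table, List.mem_append]; tauto

/-- Rows of chunk `rank3Rows27` are rows of the census table. [folklore] -/
theorem mem_rank3Table_of_mem_rows27 {r : Rank3Row} (h : r ∈ rank3Rows27) : r ∈ rank3Table := by
  simp only [rank3Table, List.mem_append]; tauto

/-- A row at position `i` of a chunk is a member of the chunk (`List.mem_iff_getElem?`; the position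
is certified by `rfl`). [folklore] -/
theorem mem_of_getElem?_eq {rows : List Rank3Row} {r : Rank3Row} (i : ℕ) (h : rows[i]? = some r) :
    r ∈ rows :=
  List.mem_iff_getElem?.mpr ⟨i, h⟩

/-- **`L(E,1) = 0` and `L′(E,1) = 0` exactly for a census row with `3 ≤ rank_ℤ E(ℚ)` DISCHARGED**
(kernel certificate), given only Gross–Zagier–Kolyvagin (`hGZK`, bsd.S17) — the contrapositive
`r_an ≤ 1 ⇒ rank ≤ 1`. [cite: CremonaAlgorithms1997, §2.13] [cite: Darmon2004, Thm. 3.22] -/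
theorem Rank3Row.lvalues_eq_zero_of_three_le {r : Rank3Row} (hr : r ∈ rank3Table)
    (hGZK : rank_eq_analyticRank_of_analyticRank_le_one) (h3 : 3 ≤ r.curve.mordellWeilRank) :
    r.curve.entireLFunction 1 = 0 ∧ deriv r.curve.entireLFunction 1 = 0 := by
  haveI := isElliptic_of_mem hr
  have h2 : 2 ≤ r.curve.mordellWeilRank := le_trans (by norm_num) h3
  exact ⟨entireLFunction_one_eq_zero_of_two_le_mordellWeilRank r.curve hGZK h2,
    deriv_entireLFunction_one_eq_zero_of_two_le_mordellWeilRank r.curve hGZK h2⟩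

/-- **`r_an(E) = rank_ℤ E(ℚ)` for a census row with `hlow` DISCHARGED**: the remaining named
hypotheses are Gross–Zagier–Kolyvagin and the certificate fields `rank_upper`, `L3`, `root_number`.
[cite: CremonaAlgorithms1997, §2.13] [cite: Darmon2004, Thm. 3.22] -/
theorem Rank3Row.analyticRank_eq_rank_of_three_le {r : Rank3Row} (hr : r ∈ rank3Table)
    (h3 : 3 ≤ r.curve.mordellWeilRank) (hGZK : rank_eq_analyticRank_of_analyticRank_le_one)
    (hup : r.curve.mordellWeilRank ≤ 3) (hL3 : iteratedDeriv 3 r.curve.entireLFunction 1 ≠ 0)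
    (hw : r.curve.rootNumber = -1) : r.curve.analyticRank = r.curve.mordellWeilRank :=
  analyticRank_eq_rank_of_mem hr hGZK h3 hup hL3 hw

/-- **`L′(E,1) = 0` over `K = ℚ(√D)` (Gross–Zagier–Kolyvagin over `K`) for a census row with `hlow`
DISCHARGED**; the other certificate / literature inputs stay named hypotheses.
[cite: GrossLMS1991, (1.1) and Thm. 1.3] [cite: Darmon2004, Hypothesis 3.9] -/
theorem Rank3Row.rank3_lderiv_eq_zero_of_three_le {r : Rank3Row} (hr : r ∈ rank3Table)
    (h3 : 3 ≤ r.curve.mordellWeilRank) (K : Type) [Field K] [NumberField K]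
    (hE : WeierstrassCurve.hasEntireLFunction_rat)
    (hGZKK : mordellWeilRank_eq_one_of_LDerivEK_ne_zero r.curve K)
    (hmin : r.curve.IsGloballyMinimal) (hN : r.curve.conductorNorm ℤ = r.N)
    (hK : IsImaginaryQuadratic K) (hdK : NumberField.discr K = r.D)
    (hw : r.curve.rootNumber = -1) (hLD : (r.curve.quadraticTwist (r.D : ℚ)).entireLFunction 1 ≠ 0) :
    deriv r.curve.entireLFunction 1 = 0 :=
  rank3_lderiv_eq_zero_of_mem hr K hE hGZKK hmin hN hK hdK h3 hw hLD

end Summit.BirchSwinnertonDyer.BirchSwinnertonDyer.Rank2Observatory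

end
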